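import Mathlib.FieldTheory.Finite.Basic
import Mathlib.FieldTheory.Perfect
import Literature.NumberTheory.Automorphic.Sweep2
import Literature.NumberTheory.Automorphic.RootSubgroupStructure
import HarnessLib

/-!
# Lang's theorem "connected groups over finite fields are quasi-split": reduction to named facts

Family `lang` (statement **lang.S12**, file `Literature/NumberTheory/Automorphic/Sweep2.lean`),
`namespace Literature.Lang`. The named fact `Literature.Lang.isQuasiSplitOver_of_finite k K n` (Lang 1956;
Serre, *Algebraic Groups and Class Fields*, VI §1 no. 4, Examples after Cor. 1: "Every linear
algebraic group defined over `k` [finite] has a Borel subgroup defined over `k`"; Springer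
16.2.9 (2); Malle–Testerman Cor. 21.12) says, in the `K`-points model of the prelude
`LinearAlgebraicGroups` (`K ⊇ k` algebraically closed, groups = closed subgroups of `GL n K`):
every Zariski-connected closed `G ≤ GL n K` defined over the finite field `k` contains a Borel
subgroup defined over `k`.

An honest proof needs, besides the existence of Borel subgroups (the named fact
`isQuasiSplitOver_self` of `Sweep2`, discharged in `Sweep2Proofs.lean` as
`isQuasiSplitOver_self_holds` from the dimension theory of `ZariskiGL`), the conjugacy of Borel
subgroups (complete varieties, Borel's fixed point theorem) and Lang's surjectivity theorem
(tangent spaces, or dimension of fibres plus Chevalley's constructibility), neither of which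
exists in this model (triage XL). This file carries out the **decomposition**: it proves all the
glue and reduces the fact to named facts,

* `isQuasiSplitOver_self K n` (existence of Borel subgroups over `K`; `Sweep2`, discharged by
  `isQuasiSplitOver_self_holds` of `Sweep2Proofs`, which is what users feed in),
* `Literature.NumberTheory.Automorphic.isBorelIn_conj` (conjugacy of Borel subgroups, Springer 6.2.7 (iii); the
  accepted fact of `RootSubgroupStructure.lean`, reused, not restated),
* `lang_map_surjective k K n` (Lang's theorem: `x ↦ x⁻¹ F x` is onto for connected `G`;
  Serre VI §1 no. 4 Prop. 3, Springer 4.4.17) — new, below,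

see `isQuasiSplitOver_of_finite_of_facts`. What is **proved** here (sorry-free):

* transport of `IsAlgebraicSubgroup`, `IsZConnected`, `IsBorelIn` along *Zariski automorphisms*
  of `GL n K` (`IsZariskiAut`: group automorphisms mapping zero loci to zero loci both ways —
  not continuous maps for a topology compatible with the group structure, since the inverse of
  the Frobenius is not polynomial), with the instance needed here: the entrywise action
  `glMapEquiv τ` of a field automorphism `τ` of `K` (conjugation is already covered by
  `IsBorelIn.map_conj` of `TorusRigidity.lean`);
* the `q`-Frobenius `qFrobenius k K : K →+* K` (`x ↦ x ^ #k`, Mathlib's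
  `FiniteField.frobeniusAlgHom`), its fixed points `= k` (`qFrobenius_eq_self_iff`, root count of
  `X ^ q - X`), bijectivity on perfect `K`, Artin–Schreier surjectivity of `a ↦ a ^ q - a` on
  algebraically closed `K`, and the Frobenius endomorphism `frobGL k K n` of `GL n K`;
* **Galois descent for the Frobenius** (Serre VI §1 no. 1: "`W` is rational over `k` iff
  `FW = W`"; Borel AG §14; compare Springer 11.2.8 (i)): a closed `V ⊆ GL n K` is defined over
  `k` (`IsDefinedOver`, ideal-theoretic) iff `F(V) = V` (`isDefinedOver_iff_image_frobGL_eq`);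
  the key step is the descent lemma `ideal_le_span_fixed_of_map_le`: an ideal of `K[x]` stable
  under the coefficientwise Frobenius is generated by Frobenius-fixed polynomials (induction on
  the number of monomials, using the surjectivity of `a ↦ a ^ q - a`);
* Lang's construction (`exists_isBorelIn_map_frobGL_eq`): from conjugacy and Lang's theorem, a
  conjugate `x B₀ x⁻¹` (`x ∈ G`) of any Borel subgroup `B₀` is `F`-stable, hence defined over `k`;
* the equivalence of the two printed forms of the Lang map (`lang_map_surjective_iff`).

## Mathlib / tree search

Mathlib: `FiniteField.frobeniusAlgHom`, `FiniteField.frobeniusAlgEquiv`, `PerfectField`,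
`IsAlgClosed.perfectField`, `IsAlgClosed.exists_root`, `Matrix.GeneralLinearGroup.map`,
`MulAut.conj`, `Subgroup.relIndex_map_map_of_injective`, `MvPolynomial.vanishingIdeal`,
`MvPolynomial.mem_range_map_iff_coeffs_subset`, `FiniteField.X_pow_card_sub_X_natDegree_eq`.
Mathlib has no Lang theorem, no Borel subgroups, no `k`-structures (`lean search` for
`lang.?steinberg|Lang.s theorem|Steinberg endomorphism|frobGL`: no hits outside docstrings).
Tree (reused, not restated): `IsZConnected`, `IsBorelIn`, `zeroLocusGL`
(`LinearAlgebraicGroups`); `IsDefinedOver`, `IsQuasiSplitOver`, `map_vanishingIdeal_le`,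
`isQuasiSplitOver_self`, `isQuasiSplitOver_of_finite` (`Sweep2`); `IsBorelIn.map_conj`
(`TorusRigidity`); the named fact `isBorelIn_conj` (`RootSubgroupStructure`). Not imported (to
keep this file independent of it): `isQuasiSplitOver_self_holds` (`Sweep2Proofs`).

## Design choices

* The new literature result is a named fact `def … : Prop` (D-0014) stated in the `K`-points
  model exactly as the target fact, for an arbitrary algebraically closed `K ⊇ k` (Serre works
  over any algebraically closed field / universal domain, VI §1 no. 1; Springer 4.4.16 takes
  `k = 𝔽̄_q`). The Lang map is written `x ↦ x⁻¹ F x` as in Lang and Serre; Springer and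
  Malle–Testerman use `F(x) x⁻¹`, equivalent under `x ↦ x⁻¹` (`lang_map_surjective_iff`).
* `frobGL` is `Matrix.GeneralLinearGroup.map (qFrobenius k K)`; `qFrobenius` fixes the `Fintype`
  structure on `k` noncomputably (`Fintype.ofFinite`) and is characterised by `qFrobenius_apply`.
* No instances, no sorry, no new axioms.

## References

* S. Lang, *Algebraic groups over finite fields*, Amer. J. Math. 78 (1956), 555–563.
* J.-P. Serre, *Algebraic Groups and Class Fields*, GTM 117 (1988), Ch. VI §1, nos. 1 and 4
  (Prop. 3, Cor. 1 and the Examples following it).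
* T. A. Springer, *Linear Algebraic Groups*, 2nd ed. (1998), 2.1.4, 4.4.16–4.4.17, 6.2.7,
  11.2.8, 16.2.9 (2).
* G. Malle, D. Testerman, *Linear Algebraic Groups and Finite Groups of Lie Type* (2011),
  Thm. 6.4, Thm. 21.7, Thm. 21.11, Cor. 21.12.
* A. Borel, *Linear Algebraic Groups*, 2nd ed. (1991), AG §14, 11.1, 16.6 (as cited in `Sweep2`).
-/

noncomputable section

open scoped MatrixGroups Polynomial

namespace Literature.NumberTheory.Automorphic


/-! ### Transport of structure along automorphisms of `GL n K` preserving zero loci -/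

section Transport

variable {K : Type*} [Field K] {n : Type*} [Fintype n] [DecidableEq n]

/-- A group automorphism `e` of `GL n K` is a *Zariski automorphism* if `e` and `e⁻¹` map zero
loci of polynomials (in the coordinates `x i j, det⁻¹`) to zero loci. Example: the entrywise
action of a field automorphism of `K` (`isZariskiAut_glMapEquiv`), a homeomorphism of `GL n K`
for the Zariski topology compatible with the group law (Springer, *Linear Algebraic Groups*,
4.4.16; Serre VI §1 no. 1). [folklore] -/
structure IsZariskiAut (e : GL n K ≃* GL n K) : Prop where
  /-- `e` maps zero loci to zero loci. -/
  image : ∀ S : Set (MvPolynomial (GLCoord n) K), ∃ S' : Set (MvPolynomial (GLCoord n) K),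
    e '' zeroLocusGL S = zeroLocusGL S'
  /-- `e⁻¹` maps zero loci to zero loci. -/
  symm_image : ∀ S : Set (MvPolynomial (GLCoord n) K), ∃ S' : Set (MvPolynomial (GLCoord n) K),
    e.symm '' zeroLocusGL S = zeroLocusGL S'

namespace IsZariskiAut

variable {e : GL n K ≃* GL n K}

/-- The inverse of a Zariski automorphism is one. [folklore] -/
theorem symm (he : IsZariskiAut e) : IsZariskiAut e.symm :=
  ⟨he.symm_image, by simpa using he.image⟩

/-- `e (e⁻¹ H) = H`. [folklore] -/
theorem map_symm_map (H : Subgroup (GL n K)) :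
    (H.map (e.symm : GL n K →* GL n K)).map (e : GL n K →* GL n K) = H :=
  (Subgroup.map_symm_eq_iff_map_eq _).mp rfl

/-- `e⁻¹ (e H) = H`. [folklore] -/
theorem map_map_symm (H : Subgroup (GL n K)) :
    (H.map (e : GL n K →* GL n K)).map (e.symm : GL n K →* GL n K) = H :=
  (Subgroup.map_symm_eq_iff_map_eq _).mpr rfl

/-- Zariski automorphisms preserve algebraic (closed) subgroups. [folklore] -/
theorem isAlgebraicSubgroup_map (he : IsZariskiAut e) {H : Subgroup (GL n K)}
    (hH : IsAlgebraicSubgroup H) : IsAlgebraicSubgroup (H.map (e : GL n K →* GL n K)) := by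
  obtain ⟨S, hS⟩ := hH
  obtain ⟨S', hS'⟩ := he.image S
  exact ⟨S', by rw [Subgroup.coe_map, MonoidHom.coe_coe, hS, hS']⟩

/-- Group automorphisms preserve finiteness of relative indices. [folklore] -/
theorem finiteIndex_map_iff (H G : Subgroup (GL n K)) :
    ((H.map (e : GL n K →* GL n K)).subgroupOf (G.map (e : GL n K →* GL n K))).FiniteIndex ↔
      (H.subgroupOf G).FiniteIndex := by
  rw [Subgroup.finiteIndex_iff, Subgroup.finiteIndex_iff]
  change (H.map _).relIndex _ ≠ 0 ↔ H.relIndex G ≠ 0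
  rw [Subgroup.relIndex_map_map_of_injective H G (EquivLike.injective e)]

/-- Zariski automorphisms preserve Zariski-connectedness (`IsZConnected`: closed, without proper
closed subgroups of finite index). [folklore] -/
theorem isZConnected_map (he : IsZariskiAut e) {G : Subgroup (GL n K)} (hG : IsZConnected G) :
    IsZConnected (G.map (e : GL n K →* GL n K)) := by
  refine ⟨he.isAlgebraicSubgroup_map hG.1, fun H' hH'G hH' hfi => ?_⟩
  set H := H'.map (e.symm : GL n K →* GL n K) with hHdef
  have hHG : H ≤ G := by
    have := Subgroup.map_mono (f := (e.symm : GL n K →* GL n K)) hH'G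
    rwa [map_map_symm] at this
  have hHalg : IsAlgebraicSubgroup H := he.symm.isAlgebraicSubgroup_map hH'
  have hHfi : (H.subgroupOf G).FiniteIndex := by
    have h := (finiteIndex_map_iff (e := e.symm) H' (G.map (e : GL n K →* GL n K))).mpr hfi
    rwa [map_map_symm] at h
  have hHG' : H = G := hG.2 H hHG hHalg hHfi
  rw [← map_symm_map (e := e) H', ← hHdef, hHG']

/-- Group automorphisms preserve solvability of subgroups. [folklore] -/
theorem isSolvable_map (e : GL n K ≃* GL n K) {H : Subgroup (GL n K)} (hH : IsSolvable ↥H) :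
    IsSolvable ↥(H.map (e : GL n K →* GL n K)) :=
  solvable_of_surjective (f := (e.subgroupMap H).toMonoidHom) (e.subgroupMap H).surjective

/-- Zariski automorphisms map Borel subgroups of `G` (`IsBorelIn`: maximal Zariski-connected
solvable closed subgroups) to Borel subgroups of the image of `G`. [folklore] -/
theorem isBorelIn_map (he : IsZariskiAut e) {B G : Subgroup (GL n K)} (hB : IsBorelIn B G) :
    IsBorelIn (B.map (e : GL n K →* GL n K)) (G.map (e : GL n K →* GL n K)) := by
  obtain ⟨hBG, hBc, hBs, hmax⟩ := hB
  refine ⟨Subgroup.map_mono hBG, he.isZConnected_map hBc, isSolvable_map e hBs,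
    fun B' hBB' hB'G hB'c hB's => ?_⟩
  set B'' := B'.map (e.symm : GL n K →* GL n K) with hB''def
  have h1 : B ≤ B'' := by
    have := Subgroup.map_mono (f := (e.symm : GL n K →* GL n K)) hBB'
    rwa [map_map_symm] at this
  have h2 : B'' ≤ G := by
    have := Subgroup.map_mono (f := (e.symm : GL n K →* GL n K)) hB'G
    rwa [map_map_symm] at this
  have h3 : IsZConnected B'' := he.symm.isZConnected_map hB'c
  have h4 : IsSolvable ↥B'' := isSolvable_map e.symm hB's
  have hB''B : B'' = B := hmax B'' h1 h2 h3 h4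
  rw [← map_symm_map (e := e) B', ← hB''def, hB''B]

end IsZariskiAut

/-! #### Conjugation -/

/-- `conj a ∘ conj b = conj (a * b)` as monoid endomorphisms. [folklore] -/
theorem conj_comp_conj (a b : GL n K) :
    (MulAut.conj a : GL n K →* GL n K).comp (MulAut.conj b : GL n K →* GL n K) =
      (MulAut.conj (a * b) : GL n K →* GL n K) := by
  ext y
  simp [MulAut.conj_apply, mul_assoc]

/-! #### Field endomorphisms and automorphisms acting entrywise -/

/-- The coordinates of `GL(τ) g` are `τ` applied to those of `g` (for `det⁻¹` because `τ` is a
ring homomorphism). [folklore] -/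
theorem glCoordFun_map (τ : K →+* K) (g : GL n K) (c : GLCoord n) :
    glCoordFun (Matrix.GeneralLinearGroup.map τ g) c = τ (glCoordFun g c) := by
  rcases c with ⟨i, j⟩ | u
  · simp
  · simp only [glCoordFun_inr, Matrix.GeneralLinearGroup.val_map_apply, map_inv₀]
    rw [← RingHom.mapMatrix_apply, ← RingHom.map_det]

/-- Function form of `glCoordFun_map`. [folklore] -/
theorem glCoordFun_map_eq_comp (τ : K →+* K) (g : GL n K) :
    glCoordFun (Matrix.GeneralLinearGroup.map τ g) = τ ∘ glCoordFun g :=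
  funext (glCoordFun_map τ g)

/-- `(τp)(GL(τ) g) = τ (p(g))`, where `τp` applies `τ` to the coefficients of `p`
(Serre VI §1 no. 1: `f ∘ F = f^q` for `k`-rational `f`). [folklore] -/
theorem eval_glCoordFun_map (τ : K →+* K) (g : GL n K) (p : MvPolynomial (GLCoord n) K) :
    MvPolynomial.eval (glCoordFun (Matrix.GeneralLinearGroup.map τ g)) (MvPolynomial.map τ p) =
      τ (MvPolynomial.eval (glCoordFun g) p) := by
  rw [glCoordFun_map_eq_comp, MvPolynomial.eval_map, MvPolynomial.eval₂_comp]

/-- `GL(τ)⁻¹ (Z(τ S)) = Z(S)` for a ring endomorphism `τ` of the field `K`. [folklore] -/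
theorem preimage_map_zeroLocusGL (τ : K →+* K) (S : Set (MvPolynomial (GLCoord n) K)) :
    Matrix.GeneralLinearGroup.map τ ⁻¹' zeroLocusGL (MvPolynomial.map τ '' S) = zeroLocusGL S := by
  ext g
  simp only [Set.mem_preimage, zeroLocusGL, Set.mem_setOf_eq, Set.forall_mem_image,
    eval_glCoordFun_map, map_eq_zero_iff τ τ.injective]

/-- The entrywise action of a field automorphism `τ` of `K` on `GL n K`, as a group
automorphism. [folklore] -/
def glMapEquiv (τ : K ≃+* K) : GL n K ≃* GL n K :=
  MonoidHom.toMulEquiv (Matrix.GeneralLinearGroup.map (τ : K →+* K))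
    (Matrix.GeneralLinearGroup.map (τ.symm : K →+* K))
    (by rw [← Matrix.GeneralLinearGroup.map_comp]; simp)
    (by rw [← Matrix.GeneralLinearGroup.map_comp]; simp)

/-- `glMapEquiv τ` is `GL(τ)` (definitional). [folklore] -/
@[simp] theorem glMapEquiv_apply (τ : K ≃+* K) (g : GL n K) :
    glMapEquiv τ g = Matrix.GeneralLinearGroup.map (τ : K →+* K) g := rfl

/-- The inverse of `glMapEquiv τ` is `glMapEquiv τ⁻¹` (definitional). [folklore] -/
@[simp] theorem glMapEquiv_symm (τ : K ≃+* K) :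
    (glMapEquiv (n := n) τ).symm = glMapEquiv τ.symm := rfl

/-- `GL(τ) (Z(S)) = Z(τ S)` for a field automorphism `τ` (Serre VI §1 no. 1, the variety
`V^p`). [folklore] -/
theorem image_glMapEquiv_zeroLocusGL (τ : K ≃+* K) (S : Set (MvPolynomial (GLCoord n) K)) :
    glMapEquiv τ '' zeroLocusGL S = zeroLocusGL (MvPolynomial.map (τ : K →+* K) '' S) := by
  rw [← preimage_map_zeroLocusGL (τ : K →+* K) S]
  change glMapEquiv τ '' (glMapEquiv τ ⁻¹' _) = _
  exact Set.image_preimage_eq _ (glMapEquiv τ).surjective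

/-- Field automorphisms act as Zariski automorphisms of `GL n K`. [folklore] -/
theorem isZariskiAut_glMapEquiv (τ : K ≃+* K) : IsZariskiAut (glMapEquiv (n := n) τ) :=
  ⟨fun S => ⟨_, image_glMapEquiv_zeroLocusGL τ S⟩,
    fun S => ⟨_, by rw [glMapEquiv_symm]; exact image_glMapEquiv_zeroLocusGL τ.symm S⟩⟩

end Transport

/-! ### The `q`-Frobenius of `K ⊇ k`, `q = #k` -/

section Frobenius

variable (k K : Type*) [Field k] [Field K] [Algebra k K]

/-- The `q`-power map `x ↦ x ^ q`, `q = Nat.card k`, as a ring endomorphism of a field `K`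
containing the finite field `k` (Mathlib's `FiniteField.frobeniusAlgHom`, with the `Fintype`
structure on `k` chosen noncomputably; Serre VI §1 no. 1). [folklore] -/
def qFrobenius [Finite k] : K →+* K :=
  haveI := Fintype.ofFinite k
  (FiniteField.frobeniusAlgHom k K).toRingHom

variable {K} in
/-- `qFrobenius k K x = x ^ #k`. [folklore] -/
theorem qFrobenius_apply [Finite k] (x : K) : qFrobenius k K x = x ^ Nat.card k := by
  letI := Fintype.ofFinite k
  rw [Nat.card_eq_fintype_card]
  rfl

/-- The `q`-Frobenius fixes `k` pointwise (`a ^ q = a` on `k`). [folklore] -/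
theorem qFrobenius_algebraMap [Finite k] (a : k) :
    qFrobenius k K (algebraMap k K a) = algebraMap k K a := by
  letI := Fintype.ofFinite k
  exact (FiniteField.frobeniusAlgHom k K).commutes a

/-- `F ∘ ι = ι` for the inclusion `ι : k → K`. [folklore] -/
theorem qFrobenius_comp_algebraMap [Finite k] :
    (qFrobenius k K).comp (algebraMap k K) = algebraMap k K :=
  RingHom.ext (qFrobenius_algebraMap k K)

variable {K} in
/-- The fixed points of the `q`-Frobenius on `K` are exactly the image of `k` (Springer 4.4.16:
`F = {a ∈ k | a^q = a}`): `X ^ q - X` has at most `q` roots in the field `K`, and the `q`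
elements of `k` are roots. [folklore] -/
theorem qFrobenius_eq_self_iff [Finite k] {x : K} :
    qFrobenius k K x = x ↔ x ∈ Set.range (algebraMap k K) := by
  classical
  letI := Fintype.ofFinite k
  constructor
  · intro hx
    rw [qFrobenius_apply, Nat.card_eq_fintype_card] at hx
    set q := Fintype.card k with hq
    have hq1 : 1 < q := Fintype.one_lt_card
    set f : K[X] := Polynomial.X ^ q - Polynomial.X with hf
    have hf0 : f ≠ 0 := hf ▸ FiniteField.X_pow_card_sub_X_ne_zero K hq1
    -- the image of `k` consists of roots of `f`
    have himg : (Finset.univ.image (algebraMap k K)) ⊆ f.roots.toFinset := by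
      intro y hy
      obtain ⟨a, -, rfl⟩ := Finset.mem_image.mp hy
      rw [Multiset.mem_toFinset, Polynomial.mem_roots hf0, Polynomial.IsRoot.def, hf,
        Polynomial.eval_sub, Polynomial.eval_pow, Polynomial.eval_X, ← map_pow,
        FiniteField.pow_card, sub_self]
    have hcard : (f.roots.toFinset).card ≤ (Finset.univ.image (algebraMap k K)).card := by
      rw [Finset.card_image_of_injective _ (algebraMap k K).injective, Finset.card_univ]
      calc f.roots.toFinset.card ≤ Multiset.card f.roots := Multiset.toFinset_card_le _
        _ ≤ f.natDegree := Polynomial.card_roots' f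
        _ = q := FiniteField.X_pow_card_sub_X_natDegree_eq K hq1
    have heq := Finset.eq_of_subset_of_card_le himg hcard
    have hxr : x ∈ f.roots.toFinset := by
      rw [Multiset.mem_toFinset, Polynomial.mem_roots hf0, Polynomial.IsRoot.def, hf,
        Polynomial.eval_sub, Polynomial.eval_pow, Polynomial.eval_X, hx, sub_self]
    rw [← heq] at hxr
    obtain ⟨a, -, ha⟩ := Finset.mem_image.mp hxr
    exact ⟨a, ha⟩
  · rintro ⟨a, rfl⟩
    exact qFrobenius_algebraMap k K a

/-- Over a perfect field `K` (e.g. algebraically closed) the `q`-Frobenius is bijective.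
[folklore] -/
theorem qFrobenius_bijective [Finite k] [PerfectField K] : Function.Bijective (qFrobenius k K) := by
  letI := Fintype.ofFinite k
  obtain ⟨p, hp⟩ := ExpChar.exists K
  haveI := PerfectField.toPerfectRing (K := K) p
  exact (FiniteField.frobeniusAlgEquiv k K p).bijective

/-- The `q`-Frobenius as a ring automorphism of a perfect field `K ⊇ k`. [folklore] -/
def qFrobeniusEquiv [Finite k] [PerfectField K] : K ≃+* K :=
  RingEquiv.ofBijective (qFrobenius k K) (qFrobenius_bijective k K)

/-- `qFrobeniusEquiv` is `qFrobenius` as a ring homomorphism (definitional). [folklore] -/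
@[simp] theorem coe_qFrobeniusEquiv [Finite k] [PerfectField K] :
    ((qFrobeniusEquiv k K : K ≃+* K) : K →+* K) = qFrobenius k K := rfl

variable {K} in
/-- Artin–Schreier surjectivity: over an algebraically closed `K`, `a ↦ a ^ q - a` is onto
(Lang's theorem for the additive group; Serre VI §1 no. 6). [folklore] -/
theorem exists_qFrobenius_sub_self [Finite k] [IsAlgClosed K] (c : K) :
    ∃ a : K, qFrobenius k K a - a = c := by
  letI := Fintype.ofFinite k
  have hq1 : 1 < Nat.card k := by rw [Nat.card_eq_fintype_card]; exact Fintype.one_lt_card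
  set f : K[X] := Polynomial.X ^ Nat.card k - Polynomial.X - Polynomial.C c with hf
  have hdeg : f.degree ≠ 0 := by
    have h1 : (Polynomial.X ^ Nat.card k - Polynomial.X : K[X]).degree = Nat.card k := by
      rw [Polynomial.degree_sub_eq_left_of_degree_lt] <;>
        simp only [Polynomial.degree_X_pow, Polynomial.degree_X]
      exact_mod_cast hq1
    have h2 : f.degree = Nat.card k := by
      rw [hf, Polynomial.degree_sub_eq_left_of_degree_lt] <;> rw [h1]
      exact lt_of_le_of_lt Polynomial.degree_C_le (by exact_mod_cast (lt_trans zero_lt_one hq1))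
    rw [h2]
    exact_mod_cast (lt_trans zero_lt_one hq1).ne'
  obtain ⟨a, ha⟩ := IsAlgClosed.exists_root f hdeg
  refine ⟨a, ?_⟩
  rw [Polynomial.IsRoot.def, hf] at ha
  simp only [Polynomial.eval_sub, Polynomial.eval_pow, Polynomial.eval_X, Polynomial.eval_C] at ha
  rw [qFrobenius_apply]
  linear_combination ha

variable (n : Type*) [Fintype n] [DecidableEq n]

/-- The **Frobenius endomorphism** `F` of `GL n K` attached to the `k`-structure (`k` finite with
`q` elements, `K ⊇ k`): `(F g) i j = (g i j) ^ q` (Serre VI §1 no. 1; Springer 4.4.16;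
Malle–Testerman Example 21.1, the standard Frobenius map). [folklore] -/
def frobGL [Finite k] : GL n K →* GL n K :=
  Matrix.GeneralLinearGroup.map (qFrobenius k K)

variable {k K n}

/-- Entries of `F g` are `q`-th powers of the entries of `g`. [folklore] -/
@[simp] theorem frobGL_apply_apply [Finite k] (g : GL n K) (i j : n) :
    (frobGL k K n g : Matrix n n K) i j = ((g : Matrix n n K) i j) ^ Nat.card k := by
  simp [frobGL, qFrobenius_apply]

/-- For perfect `K`, `F` is the Zariski automorphism `glMapEquiv (qFrobeniusEquiv k K)`
(definitional). [folklore] -/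
theorem glMapEquiv_qFrobeniusEquiv_apply [Finite k] [PerfectField K] (g : GL n K) :
    glMapEquiv (qFrobeniusEquiv k K) g = frobGL k K n g := rfl

/-- Same as `glMapEquiv_qFrobeniusEquiv_apply`, for the underlying monoid homomorphism.
[folklore] -/
theorem coe_toMonoidHom_glMapEquiv_qFrobeniusEquiv [Finite k] [PerfectField K] :
    ((glMapEquiv (n := n) (qFrobeniusEquiv k K) : GL n K ≃* GL n K) : GL n K →* GL n K) =
      frobGL k K n :=
  MonoidHom.ext fun _ => rfl

/-- `F ∘ conj x = conj (F x) ∘ F`. [folklore] -/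
theorem frobGL_comp_conj [Finite k] (x : GL n K) :
    (frobGL k K n).comp (MulAut.conj x : GL n K →* GL n K) =
      (MulAut.conj (frobGL k K n x) : GL n K →* GL n K).comp (frobGL k K n) := by
  ext y
  simp [MulAut.conj_apply, map_mul, map_inv]

end Frobenius

/-! ### Galois descent for ideals under the Frobenius -/

section Descent

variable {K : Type*} [Field K] {σ : Type*}

/-- **Descent lemma.** Let `τ` be a ring endomorphism of the field `K` such that `a ↦ τ a - a`
is onto (e.g. the `q`-Frobenius of an algebraically closed field). If an ideal `I` of `K[x_σ]`
is stable under `τ` acting on coefficients, then `I` is generated by its `τ`-fixed elements.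
Proof: induction on the number of monomials of `p ∈ I`: normalise one coefficient to `1`, so that
`τp - p ∈ I` has fewer monomials, hence lies in the `K`-span of the fixed elements; solve
`τu - u = τp - p` inside that span using the surjectivity of `τ - 1`; then `p - u` is fixed.
(Compare Borel, *Linear Algebraic Groups*, AG §14, and Serre VI §1 no. 1, Prop. 1.) [folklore] -/
theorem ideal_le_span_fixed_of_map_le (τ : K →+* K) (hAS : ∀ c : K, ∃ a : K, τ a - a = c)
    {I : Ideal (MvPolynomial σ K)} (hI : ∀ p ∈ I, MvPolynomial.map τ p ∈ I) :
    I ≤ Ideal.span {e | e ∈ I ∧ MvPolynomial.map τ e = e} := by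
  classical
  set S : Set (MvPolynomial σ K) := {e | e ∈ I ∧ MvPolynomial.map τ e = e} with hSdef
  -- the `K`-span of `S` is contained in `I`
  have hSI : ∀ x ∈ Submodule.span K S, x ∈ I := by
    intro x hx
    induction hx using Submodule.span_induction with
    | mem x hx => exact hx.1
    | zero => exact I.zero_mem
    | add x y _ _ hx hy => exact I.add_mem hx hy
    | smul a x _ hx => rw [MvPolynomial.smul_eq_C_mul]; exact I.mul_mem_left _ hx
  -- solving `τ u - u = c • d` inside the span
  have hsolve : ∀ d ∈ Submodule.span K S, ∀ c : K, ∃ u ∈ Submodule.span K S,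
      MvPolynomial.map τ u - u = c • d := by
    intro d hd
    induction hd using Submodule.span_induction with
    | mem e he =>
      intro c
      obtain ⟨a, ha⟩ := hAS c
      refine ⟨a • e, Submodule.smul_mem _ a (Submodule.subset_span he), ?_⟩
      rw [MvPolynomial.smul_eq_C_mul, map_mul, MvPolynomial.map_C, he.2,
        MvPolynomial.smul_eq_C_mul, ← sub_mul, ← map_sub, ha]
    | zero => intro c; exact ⟨0, Submodule.zero_mem _, by simp⟩
    | add x y _ _ hx hy =>
      intro c
      obtain ⟨u, hu, hux⟩ := hx c
      obtain ⟨v, hv, hvy⟩ := hy c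
      exact ⟨u + v, Submodule.add_mem _ hu hv, by rw [map_add, smul_add, ← hux, ← hvy]; ring⟩
    | smul a x _ hx =>
      intro c
      obtain ⟨u, hu, hux⟩ := hx (c * a)
      exact ⟨u, hu, by rw [hux, mul_smul]⟩
  -- main induction on the number of monomials
  suffices h : ∀ N : ℕ, ∀ p ∈ I, p.support.card ≤ N → p ∈ Submodule.span K S by
    intro p hp
    exact Submodule.span_le_restrictScalars K (MvPolynomial σ K) S (h _ p hp le_rfl)
  intro N
  induction N with
  | zero =>
    intro p _ hcard
    have hp0 : p = 0 := by
      rwa [Nat.le_zero, Finset.card_eq_zero, MvPolynomial.support_eq_empty] at hcard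
    rw [hp0]
    exact Submodule.zero_mem _
  | succ N ih =>
    intro p hp hcard
    by_cases hp0 : p = 0
    · rw [hp0]; exact Submodule.zero_mem _
    obtain ⟨m₀, hm₀⟩ := MvPolynomial.ne_zero_iff.mp hp0
    set c := MvPolynomial.coeff m₀ p with hc
    set p₁ := c⁻¹ • p with hp₁def
    have hp₁I : p₁ ∈ I := by
      rw [hp₁def, MvPolynomial.smul_eq_C_mul]; exact I.mul_mem_left _ hp
    have hp₁m₀ : MvPolynomial.coeff m₀ p₁ = 1 := by
      rw [hp₁def, MvPolynomial.coeff_smul, smul_eq_mul, inv_mul_cancel₀ hm₀]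
    have hp₁supp : p₁.support = p.support := by
      rw [hp₁def]; exact MvPolynomial.support_smul_eq (inv_ne_zero hm₀) p
    set d := MvPolynomial.map τ p₁ - p₁ with hddef
    have hdI : d ∈ I := I.sub_mem (hI _ hp₁I) hp₁I
    have hdsupp : d.support ⊆ p.support.erase m₀ := by
      intro m hm
      rw [MvPolynomial.mem_support_iff] at hm
      rw [Finset.mem_erase]
      constructor
      · rintro rfl
        apply hm
        rw [hddef, MvPolynomial.coeff_sub, MvPolynomial.coeff_map, hp₁m₀, map_one, sub_self]
      · rw [← hp₁supp, MvPolynomial.mem_support_iff]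
        intro h0
        apply hm
        rw [hddef, MvPolynomial.coeff_sub, MvPolynomial.coeff_map, h0, map_zero, sub_self]
    have hdcard : d.support.card ≤ N := by
      have h1 := Finset.card_le_card hdsupp
      have h2 : (p.support.erase m₀).card < p.support.card :=
        Finset.card_erase_lt_of_mem (MvPolynomial.mem_support_iff.mpr hm₀)
      omega
    have hdspan : d ∈ Submodule.span K S := ih d hdI hdcard
    obtain ⟨u, hu, hud⟩ := hsolve d hdspan 1
    rw [one_smul] at hud
    have he₀ : p₁ - u ∈ S := by
      refine ⟨I.sub_mem hp₁I (hSI u hu), ?_⟩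
      have h1 : MvPolynomial.map τ p₁ = p₁ + d := by rw [hddef]; ring
      have h2 : MvPolynomial.map τ u = u + d := by rw [← hud]; ring
      rw [map_sub, h1, h2]
      ring
    have hp₁span : p₁ ∈ Submodule.span K S := by
      have : p₁ = (p₁ - u) + u := by ring
      rw [this]
      exact Submodule.add_mem _ (Submodule.subset_span he₀) hu
    have hp_eq : p = c • p₁ := by rw [hp₁def, smul_smul, mul_inv_cancel₀ hm₀, one_smul]
    rw [hp_eq]
    exact Submodule.smul_mem _ c hp₁span

end Descent

/-! ### Frobenius-stable closed sets are exactly the closed sets defined over `k` -/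

section FrobeniusDescent

variable (k : Type*) {K : Type*} [Field k] [Field K] [Algebra k K]
variable {n : Type*} [Fintype n] [DecidableEq n]

/-- **Descent** (Serre VI §1 no. 1; Borel AG §14; compare Springer 11.2.8 (i)) for `k` finite: if
`V ⊆ GL n K` satisfies `V ⊆ F(V)` for the `q`-Frobenius `F` (`K ⊇ k` algebraically closed, `k`
finite), then `V` is defined over `k`: its vanishing ideal is generated by `k`-polynomials.
[folklore] -/
theorem isDefinedOver_of_subset_image_frobGL [Finite k] [IsAlgClosed K] {V : Set (GL n K)}
    (hV : V ⊆ frobGL k K n '' V) : IsDefinedOver k V := by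
  set τ := qFrobenius k K with hτ
  have hI : ∀ p ∈ MvPolynomial.vanishingIdeal K (glCoordFun '' V),
      MvPolynomial.map τ p ∈ MvPolynomial.vanishingIdeal K (glCoordFun '' V) := by
    intro p hp
    rw [MvPolynomial.mem_vanishingIdeal_iff] at hp ⊢
    rintro _ ⟨v, hv, rfl⟩
    obtain ⟨w, hw, rfl⟩ := hV hv
    have h := eval_glCoordFun_map τ w p
    rw [MvPolynomial.aeval_eq_eval]
    change MvPolynomial.eval (glCoordFun (Matrix.GeneralLinearGroup.map τ w))
      (MvPolynomial.map τ p) = 0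
    rw [h, ← MvPolynomial.aeval_eq_eval, hp _ ⟨w, hw, rfl⟩, map_zero]
  refine le_antisymm ?_ (map_vanishingIdeal_le k V)
  intro p hp
  have hspan := ideal_le_span_fixed_of_map_le τ (exists_qFrobenius_sub_self k) hI hp
  refine (Ideal.span_le.mpr ?_) hspan
  rintro e ⟨heI, he⟩
  have hcoef : (e.coeffs : Set K) ⊆ Set.range (algebraMap k K) := by
    intro c hc
    obtain ⟨m, -, rfl⟩ := MvPolynomial.mem_coeffs_iff.mp hc
    rw [← qFrobenius_eq_self_iff k, ← MvPolynomial.coeff_map, he]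
  obtain ⟨e₀, rfl⟩ := MvPolynomial.mem_range_map_iff_coeffs_subset.mpr hcoef
  refine Ideal.mem_map_of_mem _ ?_
  rw [MvPolynomial.mem_vanishingIdeal_iff]
  intro x hx
  rw [← MvPolynomial.aeval_map_algebraMap K x e₀]
  exact (MvPolynomial.mem_vanishingIdeal_iff.mp heI) x hx

variable {k}

/-- If `V ⊆ GL n K` is closed and defined over the finite field `k`, then `F g ∈ V ↔ g ∈ V`
for the `q`-Frobenius `F`: `V` is cut out by `k`-polynomials `e`, and `e (F g) = (e g) ^ q`
(Serre VI §1 no. 1). [folklore] -/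
theorem IsDefinedOver.frobGL_mem_iff [Finite k] {V : Set (GL n K)} (hV : IsDefinedOver k V)
    (hVc : ∃ S, V = zeroLocusGL S) (g : GL n K) : frobGL k K n g ∈ V ↔ g ∈ V := by
  obtain ⟨S₀, hS₀⟩ := hVc
  -- membership in `V` ↔ killed by all `k`-polynomials vanishing on `V`
  have key : ∀ g : GL n K, g ∈ V ↔ ∀ e₀ ∈ MvPolynomial.vanishingIdeal k (glCoordFun '' V),
      MvPolynomial.eval (glCoordFun g) (MvPolynomial.map (algebraMap k K) e₀) = 0 := by
    intro g
    constructor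
    · intro hg e₀ he₀
      have h := (MvPolynomial.mem_vanishingIdeal_iff.mp he₀) (glCoordFun g) ⟨g, hg, rfl⟩
      rwa [← MvPolynomial.aeval_map_algebraMap K, MvPolynomial.aeval_eq_eval] at h
    · intro hg
      rw [hS₀]
      intro s hs
      have hsI : s ∈ MvPolynomial.vanishingIdeal K (glCoordFun '' V) := by
        rw [MvPolynomial.mem_vanishingIdeal_iff]
        rintro _ ⟨v, hv, rfl⟩
        rw [hS₀] at hv
        rw [MvPolynomial.aeval_eq_eval]
        exact hv s hs
      rw [hV, Ideal.map] at hsI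
      have hle : Ideal.span (MvPolynomial.map (algebraMap k K) ''
          ↑(MvPolynomial.vanishingIdeal k (glCoordFun '' V))) ≤
          RingHom.ker (MvPolynomial.eval (glCoordFun g)) := by
        rw [Ideal.span_le]
        rintro _ ⟨e₀, he₀, rfl⟩
        exact hg e₀ he₀
      exact hle hsI
  rw [key, key]
  refine forall₂_congr fun e₀ _ => ?_
  have hfix : MvPolynomial.map (qFrobenius k K) (MvPolynomial.map (algebraMap k K) e₀) =
      MvPolynomial.map (algebraMap k K) e₀ := by
    rw [MvPolynomial.map_map, qFrobenius_comp_algebraMap]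
  calc MvPolynomial.eval (glCoordFun (frobGL k K n g)) (MvPolynomial.map (algebraMap k K) e₀) = 0
        ↔ MvPolynomial.eval (glCoordFun (Matrix.GeneralLinearGroup.map (qFrobenius k K) g))
          (MvPolynomial.map (qFrobenius k K) (MvPolynomial.map (algebraMap k K) e₀)) = 0 := by
          rw [hfix]; rfl
    _ ↔ qFrobenius k K (MvPolynomial.eval (glCoordFun g)
          (MvPolynomial.map (algebraMap k K) e₀)) = 0 := by rw [eval_glCoordFun_map]
    _ ↔ _ := map_eq_zero_iff _ (qFrobenius k K).injective

/-- A closed `V ⊆ GL n K` defined over the finite field `k` satisfies `F⁻¹(V) = V`. [folklore] -/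
theorem IsDefinedOver.preimage_frobGL_eq [Finite k] {V : Set (GL n K)} (hV : IsDefinedOver k V)
    (hVc : ∃ S, V = zeroLocusGL S) : frobGL k K n ⁻¹' V = V :=
  Set.ext (hV.frobGL_mem_iff hVc)

/-- A closed `V ⊆ GL n K` (`K ⊇ k` perfect, `k` finite) defined over `k` is Frobenius-stable,
`F(V) = V` (Serre VI §1 no. 1; Borel AG §14). [folklore] -/
theorem IsDefinedOver.image_frobGL_eq [Finite k] [PerfectField K] {V : Set (GL n K)}
    (hV : IsDefinedOver k V) (hVc : ∃ S, V = zeroLocusGL S) : frobGL k K n '' V = V := by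
  have hsurj : Function.Surjective (frobGL k K n) := (glMapEquiv (qFrobeniusEquiv k K)).surjective
  have h := hV.preimage_frobGL_eq (K := K) (n := n) hVc
  calc frobGL k K n '' V = frobGL k K n '' (frobGL k K n ⁻¹' V) := by rw [h]
    _ = V := Set.image_preimage_eq V hsurj

variable (k) in
/-- **Frobenius criterion for `k`-structures** (`k` finite, `K ⊇ k` algebraically closed; Serre,
*Algebraic Groups and Class Fields*, VI §1 no. 1: "`W` is rational over `k` if and only if
`FW = W`"; Borel AG §14; compare Springer 11.2.8 (i)): a Zariski-closed `V ⊆ GL n K` is defined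
over `k` iff it is stable under the `q`-Frobenius. [folklore] -/
theorem isDefinedOver_iff_image_frobGL_eq [Finite k] [IsAlgClosed K] {V : Set (GL n K)}
    (hVc : ∃ S, V = zeroLocusGL S) : IsDefinedOver k V ↔ frobGL k K n '' V = V :=
  ⟨fun h => h.image_frobGL_eq hVc, fun h => isDefinedOver_of_subset_image_frobGL k h.symm.subset⟩

/-- A closed subgroup `G ≤ GL n K` defined over the finite field `k` is Frobenius-stable,
`F(G) = G` as subgroups; in particular `F` restricts to an endomorphism of `G` (its Frobenius
morphism, Springer 4.4.16). [folklore] -/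
theorem map_frobGL_eq_of_isDefinedOver [Finite k] [PerfectField K] {G : Subgroup (GL n K)}
    (hG : IsAlgebraicSubgroup G) (hGk : IsDefinedOver k (G : Set (GL n K))) :
    G.map (frobGL k K n) = G :=
  SetLike.coe_injective (by rw [Subgroup.coe_map]; exact hGk.image_frobGL_eq hG)

/-- Frobenius images of Borel subgroups of a closed `k`-subgroup `G` are Borel subgroups of `G`.
[folklore] -/
theorem isBorelIn_map_frobGL [Finite k] [PerfectField K] {B G : Subgroup (GL n K)}
    (hB : IsBorelIn B G) (hG : IsAlgebraicSubgroup G) (hGk : IsDefinedOver k (G : Set (GL n K))) :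
    IsBorelIn (B.map (frobGL k K n)) G := by
  have h := (isZariskiAut_glMapEquiv (n := n) (qFrobeniusEquiv k K)).isBorelIn_map hB
  rwa [coe_toMonoidHom_glMapEquiv_qFrobeniusEquiv, map_frobGL_eq_of_isDefinedOver hG hGk] at h

end FrobeniusDescent

/-! ### Named fact (D-0014): Lang's theorem -/

section Facts

variable (k K : Type*) [Field k] [Field K] [Algebra k K]
variable (n : Type*) [Fintype n] [DecidableEq n]

/-- **Lang's theorem** (Lang, *Amer. J. Math.* 78 (1956); Serre, *Algebraic Groups and Class
Fields*, Ch. VI §1 no. 4, Prop. 3: "The map `x → x⁻¹Fx` is surjective if `G` is connected",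
for an algebraic group `G` defined over the finite field `k`, points in an algebraically closed
field; equivalently, under `x ↦ x⁻¹`, Springer, *Linear Algebraic Groups* (2nd ed.), Thm. 4.4.17
[Lang's theorem] "`Λx = (σx)x⁻¹` defines a surjective morphism of `G`", and the Lang–Steinberg
theorem, Steinberg 1968, Malle–Testerman Thm. 21.7). In the `K`-points model: `k` finite with
`q` elements, `K ⊇ k` algebraically closed, `F = frobGL k K n` the `q`-Frobenius
`(g i j) ↦ (g i j ^ q)` of `GL n K`, which restricts to the Frobenius morphism of every closed
subgroup `G ≤ GL n K` defined over `k` (`map_frobGL_eq_of_isDefinedOver`: `F(G) = G`). If such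
a `G` is Zariski-connected then every `x ∈ G` is `g⁻¹ F(g)` for some `g ∈ G`. Named fact
(D-0014), not proved here (the printed proofs use tangent spaces, `dF = 0`, and dominance of
morphisms with surjective differential); `k`, `K`, `n` explicit, usage
`(h : lang_map_surjective k K n)`, then `h hG hGk x hx`.
[cite: Serre1988, Ch. VI §1 no. 4, Prop. 3] -/
def lang_map_surjective : Prop :=
  ∀ [Finite k] [IsAlgClosed K] ⦃G : Subgroup (GL n K)⦄, IsZConnected G →
    IsDefinedOver k (G : Set (GL n K)) → ∀ x ∈ G, ∃ g ∈ G, g⁻¹ * frobGL k K n g = x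

variable {k K n} in
/-- The two printed forms of Lang's theorem agree: `x ↦ x⁻¹ F x` (Lang, Serre) is onto `G` iff
`x ↦ F(x) x⁻¹` (Springer 4.4.17, Steinberg, Malle–Testerman 21.7) is, via `g ↦ g⁻¹`. [folklore] -/
theorem lang_map_surjective_iff :
    lang_map_surjective k K n ↔
      ∀ [Finite k] [IsAlgClosed K] ⦃G : Subgroup (GL n K)⦄, IsZConnected G →
        IsDefinedOver k (G : Set (GL n K)) → ∀ x ∈ G, ∃ g ∈ G, frobGL k K n g * g⁻¹ = x := by
  constructor
  · intro h _ _ G hG hGk x hx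
    obtain ⟨g, hgG, hg⟩ := h hG hGk x⁻¹ (G.inv_mem hx)
    refine ⟨g⁻¹, G.inv_mem hgG, ?_⟩
    rw [map_inv, inv_inv, ← inv_inv x, ← hg, mul_inv_rev, inv_inv]
  · intro h _ _ G hG hGk x hx
    obtain ⟨g, hgG, hg⟩ := h hG hGk x⁻¹ (G.inv_mem hx)
    refine ⟨g⁻¹, G.inv_mem hgG, ?_⟩
    rw [map_inv, inv_inv, ← inv_inv x, ← hg, mul_inv_rev, inv_inv]

end Facts

/-! ### Lang's theorem: connected `k`-groups over finite `k` are quasi-split (reduction) -/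

section Assembly

variable {k K : Type*} [Field k] [Field K] [Algebra k K]
variable {n : Type*} [Fintype n] [DecidableEq n]

/-- **Lang's construction of an `F`-stable Borel subgroup** (Serre VI §1 no. 4, proof of Cor. 1
and the Examples after it; Malle–Testerman Thm. 21.11 (a), Cor. 21.12): given conjugacy of Borel
subgroups (`isBorelIn_conj`) and Lang's theorem (`lang_map_surjective`), if `B₀` is a Borel
subgroup of the Zariski-connected closed `k`-group `G` (`k` finite) then some `G`-conjugate
`B = x B₀ x⁻¹` is Frobenius-stable, `F(B) = B`: write `F(B₀) = h B₀ h⁻¹` with `h ∈ G`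
(conjugacy), `h⁻¹ = x⁻¹ F(x)` with `x ∈ G` (Lang), so that `F(x) h = x` and
`F(x B₀ x⁻¹) = F(x) h B₀ h⁻¹ F(x)⁻¹ = x B₀ x⁻¹`. [folklore] -/
theorem exists_isBorelIn_map_frobGL_eq [Finite k] [IsAlgClosed K]
    (hconj : isBorelIn_conj (k := K) (n := n)) (hLang : lang_map_surjective k K n)
    {G B₀ : Subgroup (GL n K)} (hG : IsZConnected G) (hGk : IsDefinedOver k (G : Set (GL n K)))
    (hB₀ : IsBorelIn B₀ G) :
    ∃ x ∈ G, (B₀.map (MulAut.conj x : GL n K →* GL n K)).map (frobGL k K n) =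
      B₀.map (MulAut.conj x : GL n K →* GL n K) := by
  -- `F(B₀)` is a Borel subgroup of `G`, hence conjugate to `B₀`: `F(B₀) = h B₀ h⁻¹`
  obtain ⟨h, hhG, hconjB⟩ := hconj hG hB₀ (isBorelIn_map_frobGL hB₀ hG.1 hGk)
  -- Lang: `h⁻¹ = x⁻¹ F(x)`
  obtain ⟨x, hxG, hx⟩ := hLang hG hGk h⁻¹ (G.inv_mem hhG)
  refine ⟨x, hxG, ?_⟩
  have hxh : frobGL k K n x * h = x := by
    have h1 : frobGL k K n x = x * h⁻¹ := by rw [← hx]; group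
    rw [h1]; group
  calc (B₀.map (MulAut.conj x : GL n K →* GL n K)).map (frobGL k K n)
        = B₀.map ((frobGL k K n).comp (MulAut.conj x : GL n K →* GL n K)) :=
          Subgroup.map_map _ _ _
    _ = B₀.map ((MulAut.conj (frobGL k K n x) : GL n K →* GL n K).comp (frobGL k K n)) := by
          rw [frobGL_comp_conj]
    _ = (B₀.map (frobGL k K n)).map (MulAut.conj (frobGL k K n x) : GL n K →* GL n K) :=
          (Subgroup.map_map _ _ _).symm
    _ = (B₀.map (MulAut.conj h : GL n K →* GL n K)).map
          (MulAut.conj (frobGL k K n x) : GL n K →* GL n K) := by rw [hconjB]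
    _ = B₀.map ((MulAut.conj (frobGL k K n x) : GL n K →* GL n K).comp
          (MulAut.conj h : GL n K →* GL n K)) := Subgroup.map_map _ _ _
    _ = B₀.map (MulAut.conj (frobGL k K n x * h) : GL n K →* GL n K) := by
          rw [conj_comp_conj]
    _ = B₀.map (MulAut.conj x : GL n K →* GL n K) := by rw [hxh]

/-- Under existence and conjugacy of Borel subgroups and Lang's theorem, a Zariski-connected
closed `k`-group (`k` finite, `K ⊇ k` algebraically closed) has a Borel subgroup defined over `k`
(the hypothesis `hB` is fed `isQuasiSplitOver_self_holds` of `Sweep2Proofs`). [folklore] -/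
theorem isQuasiSplitOver_of_facts [Finite k] [IsAlgClosed K] (hB : isQuasiSplitOver_self K n)
    (hconj : isBorelIn_conj (k := K) (n := n)) (hLang : lang_map_surjective k K n)
    {G : Subgroup (GL n K)} (hG : IsZConnected G) (hGk : IsDefinedOver k (G : Set (GL n K))) :
    IsQuasiSplitOver k G := by
  obtain ⟨B₀, hB₀, -⟩ := hB hG
  obtain ⟨x, hxG, hBx⟩ := exists_isBorelIn_map_frobGL_eq @hconj @hLang hG hGk hB₀
  refine ⟨B₀.map (MulAut.conj x : GL n K →* GL n K), hB₀.map_conj hxG, ?_⟩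
  apply isDefinedOver_of_subset_image_frobGL k
  rw [← Subgroup.coe_map, hBx]

/-- **lang.S12, reduction of Lang's theorem `isQuasiSplitOver_of_finite` to named facts.**
Existence of Borel subgroups over `K` (`isQuasiSplitOver_self`, fed by
`isQuasiSplitOver_self_holds`), conjugacy of Borel subgroups (`Literature.NumberTheory.Automorphic.isBorelIn_conj`,
Springer 6.2.7 (iii)) and Lang's theorem (`lang_map_surjective`, Serre VI §1 no. 4 Prop. 3)
imply: a Zariski-connected closed
subgroup `G ≤ GL n K` defined over a finite field `k` (`K ⊇ k` algebraically closed) has a Borel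
subgroup defined over `k` (Lang 1956; Serre VI §1 no. 4, Examples: "Every linear algebraic group
defined over `k` has a Borel subgroup defined over `k`"; Springer 16.2.9 (2); Malle–Testerman
Cor. 21.12). The glue — Frobenius descent `isDefinedOver_iff_image_frobGL_eq` and transport of
Borel subgroups along the Frobenius — is proved above. [folklore] -/
theorem isQuasiSplitOver_of_finite_of_facts (hB : isQuasiSplitOver_self K n)
    (hconj : isBorelIn_conj (k := K) (n := n)) (hLang : lang_map_surjective k K n) :
    isQuasiSplitOver_of_finite k K n := by
  intro _ _ G hG hGk
  exact isQuasiSplitOver_of_facts @hB @hconj @hLang hG hGk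

end Assembly

end Literature.NumberTheory.Automorphic
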